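import Literature.Probability.RandomPlanarGeometry.SimpleCurves

/-!
# drefute stmt-CriticalPhenomena-4982 / line `marked-point-revisit` — Stub 2 `stub_markedOfShadowing`

Refuter's survival certificate for the deterministic stub 2 of
`Cruxes/SimpleSubseqLimits/Lines/marked-point-revisit.lean`: the stub is PROVED with the exact
registered signature (definitions `ShadowConfig`, `MarkedConfig` copied verbatim, same namespace).
The hypotheses `Set.range γ = Set.range η` and `γ 0 = η 0` are used as follows: `range` is NOT used
(noted `_hrange`); `γ 0 = η 0` is used only to know `γ 0 ∉ closedBall z R` (it could be replaced by
shrinking `U`, see NOTES).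
-/

noncomputable section

open Set Metric Topology
open Literature.Probability.RandomPlanarGeometry
open scoped unitInterval

namespace Summit.CriticalPhenomena.SAWScalingLimit.Cruxes.SimpleSubseqLimits.MarkedPointRevisit

/-- verbatim from the skeleton -/
def ShadowConfig (η γ : Curve ℂ) (s t y₀ y₁ : I) : Prop :=
  s < t ∧ y₀ < y₁ ∧ γ s = η y₁ ∧ (∀ r : I, r < s → γ r ≠ η y₁) ∧
    (∀ r : I, r ≤ t → ∃ y : I, y ≤ y₁ ∧ γ r = η y) ∧
    ∀ y : I, y₀ ≤ y → y < y₁ →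
      (∃ r : I, r < s ∧ γ r = η y) ∧ (∃ r' : I, s < r' ∧ r' ≤ t ∧ γ r' = η y)

/-- verbatim from the skeleton -/
def MarkedConfig (γ : Curve ℂ) (z : ℂ) (ρ R : ℝ) (lam T : I) : Prop :=
  lam < T ∧ γ lam ∈ sphere z R ∧ (∀ u : I, lam ≤ u → u ≤ T → γ u ∈ closedBall z R) ∧
    γ T ∈ closedBall z ρ ∧ ∀ u : I, u < T → γ u ∉ closedBall z ρ

/-- The good parameter set of stub 2: centre `ρ`-close to the new extreme point `P = η y₁`, and the
`R`-ball around the centre at distance `< d = infDist P (η '' [0, y₀])` from `P`. -/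
def goodParams (P : ℂ) (d : ℝ) : Set (ℂ × ℝ × ℝ) :=
  {p | 0 < p.2.1 ∧ p.2.1 < p.2.2 ∧ dist p.1 P < p.2.1 ∧ p.2.2 + dist p.1 P < d}

theorem isOpen_goodParams (P : ℂ) (d : ℝ) : IsOpen (goodParams P d) := by
  have h1 : Continuous fun p : ℂ × ℝ × ℝ => p.2.1 := continuous_fst.comp continuous_snd
  have h2 : Continuous fun p : ℂ × ℝ × ℝ => p.2.2 := continuous_snd.comp continuous_snd
  have h3 : Continuous fun p : ℂ × ℝ × ℝ => dist p.1 P := continuous_fst.dist continuous_const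
  have h : goodParams P d = ({p | 0 < p.2.1} ∩ {p | p.2.1 < p.2.2}) ∩
      ({p | dist p.1 P < p.2.1} ∩ {p : ℂ × ℝ × ℝ | p.2.2 + dist p.1 P < d}) := by
    ext p; simp only [goodParams, mem_inter_iff, mem_setOf_eq]; tauto
  rw [h]
  exact ((isOpen_lt continuous_const h1).inter (isOpen_lt h1 h2)).inter
    ((isOpen_lt h3 h1).inter (isOpen_lt (h2.add h3) continuous_const))

theorem goodParams_nonempty (P : ℂ) {d : ℝ} (hd : 0 < d) : (goodParams P d).Nonempty :=
  ⟨(P, d / 4, d / 2), by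
    refine ⟨by positivity, by linarith, by simp; positivity, ?_⟩
    simp; linarith⟩

/-- **Stub 2, proved.** Exact registered signature of `stub_markedOfShadowing`. -/
theorem stub_markedOfShadowing :
    ∀ (η γ : Curve ℂ), η.IsSimple → Set.range γ = Set.range η → γ 0 = η 0 →
      ∀ s t y₀ y₁ : I, ShadowConfig η γ s t y₀ y₁ →
        ∃ U : Set (ℂ × ℝ × ℝ), IsOpen U ∧ U.Nonempty ∧
          ∀ p ∈ U, ∃ lam T t' : I,
            MarkedConfig γ p.1 p.2.1 p.2.2 lam T ∧ T < t' ∧ γ t' = γ lam := by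
  intro η γ hη _hrange h0 s t y₀ y₁ hcfg
  obtain ⟨hst, hy01, hγs, hfirst, hbelow, hshadow⟩ := hcfg
  -- the new extreme point and the compact initial arc
  set P : ℂ := η y₁ with hP
  set K : Set ℂ := η '' Icc 0 y₀ with hK
  have hKc : IsCompact K := isCompact_Icc.image η.continuous
  have hKne : K.Nonempty := ⟨η 0, 0, ⟨le_rfl, y₀.2.1⟩, rfl⟩
  have hPK : P ∉ K := by
    rintro ⟨y, hy, hyP⟩
    have : y = y₁ := hη hyP
    exact absurd hy.2 (this ▸ not_le.2 hy01)
  set d : ℝ := infDist P K with hd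
  have hdpos : 0 < d := (hKc.isClosed.notMem_iff_infDist_pos hKne).1 hPK
  -- points of `K` are `≥ d` away from `P`
  have hKfar : ∀ y : I, y ≤ y₀ → d ≤ dist (η y) P := fun y hy => by
    rw [dist_comm]; exact infDist_le_dist_of_mem ⟨y, ⟨y.2.1, hy⟩, rfl⟩
  refine ⟨goodParams P d, isOpen_goodParams P d, goodParams_nonempty P hdpos, ?_⟩
  rintro ⟨z, ρ, R⟩ ⟨hρ, hρR, hzP, hRd⟩
  simp only at hρ hρR hzP hRd ⊢
  -- distance to the centre along `γ`
  set g : I → ℝ := fun u => dist (γ u) z with hg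
  have hgc : Continuous g := γ.continuous.dist continuous_const
  -- `γ 0` is outside the big ball
  have hg0 : R < g 0 := by
    have h1 : d ≤ dist (γ 0) P := by rw [h0]; exact hKfar 0 y₀.2.1
    have h2 : dist (γ 0) P ≤ dist (γ 0) z + dist z P := dist_triangle _ _ _
    show R < dist (γ 0) z
    linarith
  -- `γ s = P` is inside the small ball
  have hgs : g s ≤ ρ := by
    show dist (γ s) z ≤ ρ
    rw [hγs, dist_comm]; exact hzP.le
  -- T := first hitting time of `closedBall z ρ`
  set A : Set I := {u | g u ≤ ρ} with hA
  have hAc : IsClosed A := isClosed_le hgc continuous_const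
  obtain ⟨T, hTA, hTle⟩ := hAc.isCompact.exists_isLeast ⟨s, hgs⟩
  have hTs : T ≤ s := hTle hgs
  have hT0 : 0 < T := by
    rcases eq_or_lt_of_le (unitInterval.nonneg' : (0 : I) ≤ T) with h | h
    · exact absurd (h ▸ hTA : g 0 ≤ ρ) (not_le.2 (hρR.trans hg0))
    · exact h
  -- lam := last time `≤ T` at distance `≥ R`
  set B : Set I := {u | u ≤ T ∧ R ≤ g u} with hB
  have hBc : IsClosed B := (isClosed_le continuous_id continuous_const).inter
    (isClosed_le continuous_const hgc)
  obtain ⟨lam, ⟨hlamT, hlamR⟩, hlamge⟩ := hBc.isCompact.exists_isGreatest ⟨0, unitInterval.nonneg', hg0.le⟩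
  have hgT : g T ≤ ρ := hTA
  have hlamT' : lam < T := by
    rcases eq_or_lt_of_le hlamT with h | h
    · exact absurd (h ▸ hlamR) (not_le.2 (hgT.trans_lt hρR))
    · exact h
  -- `g lam = R` by the intermediate value theorem on `[lam, T]`
  have hglam : g lam = R := by
    by_contra hne
    have hgt : R < g lam := lt_of_le_of_ne hlamR (Ne.symm hne)
    have hIVT := intermediate_value_Icc' hlamT hgc.continuousOn
      (⟨(hgT.trans hρR.le), hgt.le⟩ : R ∈ Icc (g T) (g lam))
    obtain ⟨u, ⟨hlu, huT⟩, hgu⟩ := hIVT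
    have hul : u ≤ lam := hlamge ⟨huT, hgu.ge⟩
    have : u = lam := le_antisymm hul hlu
    exact hne (this ▸ hgu)
  -- the marked configuration
  have hmk : MarkedConfig γ z ρ R lam T := by
    refine ⟨hlamT', ?_, ?_, hgT, ?_⟩
    · rw [mem_sphere]; exact hglam
    · intro u hlu huT
      rw [mem_closedBall]
      by_contra hgu
      have hgu' : R ≤ g u := (not_le.1 hgu).le
      have hul : u ≤ lam := hlamge ⟨huT, hgu'⟩
      have : u = lam := le_antisymm hul hlu
      exact hgu (by rw [this]; exact hglam.le)
    · intro u huT hgu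
      exact absurd (hTle (show g u ≤ ρ from hgu)) (not_le.2 huT)
  -- the marked point lies on the shadowed sub-arc
  have hlamt : lam ≤ t := (hlamT'.le.trans hTs).trans hst.le
  obtain ⟨y, hyle, hγlam⟩ := hbelow lam hlamt
  have hyne : y ≠ y₁ := by
    rintro rfl
    exact hfirst lam (hlamT'.trans_le hTs) hγlam
  have hylt : y < y₁ := lt_of_le_of_ne hyle hyne
  have hy0 : y₀ ≤ y := by
    by_contra hlt
    have h1 : d ≤ dist (η y) P := hKfar y (not_le.1 hlt).le
    have h2 : dist (η y) P ≤ dist (η y) z + dist z P := dist_triangle _ _ _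
    have h3 : dist (η y) z = R := by rw [← hγlam]; exact hglam
    linarith
  obtain ⟨-, r', hsr', -, hγr'⟩ := hshadow y hy0 hylt
  exact ⟨lam, T, r', hmk, hTs.trans_lt hsr', by rw [hγr', hγlam]⟩

end Summit.CriticalPhenomena.SAWScalingLimit.Cruxes.SimpleSubseqLimits.MarkedPointRevisit

end
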